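import Mathlib.Combinatorics.SimpleGraph.Walk.Maps
import Mathlib.Combinatorics.SimpleGraph.Paths
import Mathlib.Combinatorics.SimpleGraph.Connectivity.Connected
import HarnessLib

/-!
# The local modification for the graph–subgraph strict inequality: rerouting through an enhancement edge

builds on p205010 (kernel theorem, internal audit signed; external expert review pending) — nothing in this file uses p205010.
Lane `prim-bschramm`, seat `prim-bschramm-p4` gen 10 (PART C3, tier 2′ of `P4-GENERAL.md`).  Helper file
(`--supports stmt-CriticalPhenomena-4575 --as helper`).  Pure graph theory, no probability.

Setting: a graph `H` ("the big graph"), configurations `ω ⊆ Sym2 V` (open edges; only edges of `H` count, `SubLoc.og`), a finite-ish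
region `Ω` with complement `F`, a root `o`, and the EXIT EVENT `SubLoc.exitEv Ω o = {ω | o ↔ F by ω-open H-edges}`.  For the
Aizenman–Grimmett differential inequality one needs, for every configuration in which an edge `e = {x,y}` of the SUBGRAPH is pivotal, a
configuration differing from it only near `e` in which an ENHANCEMENT edge (an edge of `H` not in the subgraph) is pivotal.  The
combinatorial device of this file (Balister–Bollobás–Riordan's "cut at the first entrance and rebuild cleanly" for bond models, arXiv:1402.0834
§"bond percolation", made geometry-free): a ROUTE `u —R₁→ a —f— b —R₂→ v` inside a zone `Z ∋ x, y` from the first `Z`-vertex `u` of an open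
path `o ↔ x` to a vertex `v` that is in `F` or is the first `Z`-vertex of an open path from `F`; the modified configuration opens `R₁, R₂`,
closes every other edge inside `T = V(R₁) ∪ V(R₂)` and every edge from `T ∖ {u, v}` to the outside, and then `f` is pivotal
(`SubLoc.RouteData.modify_not_mem/insert_mem`), provided `V(R₁) ⊆ Ω` and `V(R₁) ∩ V(R₂) = ∅`.  Also: the orientation lemma for a pivotal edge
(`exists_side_of_pivotal`) and the first-entrance lemma (`exists_first_hit`).  The existence of routes from CYCLE data is the sequel file.
-/

namespace Summit.CriticalPhenomena.PercolationContinuityZ3.Theorems.Transplant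

namespace SubLoc

open SimpleGraph

variable {V : Type} (H : SimpleGraph V)

/-! ## §1 Open graphs and the exit event -/

/-- The open graph of a configuration `ω`: the edges of `H` that lie in `ω`. [folklore] -/
def og (ω : Set (Sym2 V)) : SimpleGraph V := SimpleGraph.fromEdgeSet (ω ∩ H.edgeSet)

variable {H}

/-- Adjacency in the open graph. [folklore] -/
theorem og_adj {ω : Set (Sym2 V)} {a b : V} : (og H ω).Adj a b ↔ s(a, b) ∈ ω ∧ H.Adj a b := by
  rw [og, fromEdgeSet_adj]
  constructor
  · rintro ⟨⟨h1, h2⟩, -⟩; exact ⟨h1, h2⟩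
  · rintro ⟨h1, h2⟩; exact ⟨⟨h1, h2⟩, h2.ne⟩

/-- The open graph is a subgraph of `H`. [folklore] -/
theorem og_le (ω : Set (Sym2 V)) : og H ω ≤ H := fun _ _ h => (og_adj.1 h).2

/-- The open graph is monotone in the configuration. [folklore] -/
theorem og_mono {ω ω' : Set (Sym2 V)} (h : ω ⊆ ω') : og H ω ≤ og H ω' :=
  fun _ _ hab => og_adj.2 ⟨h (og_adj.1 hab).1, (og_adj.1 hab).2⟩

variable (H)

/-- **The exit event**: `o` is joined to a vertex outside `Ω` by `ω`-open edges of `H`. [folklore] -/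
def exitEv (Ω : Set V) (o : V) : Set (Set (Sym2 V)) := {ω | ∃ v, v ∉ Ω ∧ (og H ω).Reachable o v}

variable {H}

/-- The exit event is increasing. [folklore] -/
theorem isUpperSet_exitEv (Ω : Set V) (o : V) : IsUpperSet (exitEv H Ω o) := by
  rintro ω ω' hle ⟨v, hv, hr⟩
  exact ⟨v, hv, hr.mono (og_mono hle)⟩

/-- Outside the exit event every vertex reachable from `o` lies in `Ω`. [folklore] -/
theorem mem_of_reachable_of_not_exit {Ω : Set V} {o : V} {ω : Set (Sym2 V)} (h : ω ∉ exitEv H Ω o) {w : V}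
    (hw : (og H ω).Reachable o w) : w ∈ Ω := by
  by_contra hc
  exact h ⟨w, hc, hw⟩

/-! ## §2 Two walk lemmas: induction along reachability, first entrance -/

/-- A property of the root that is preserved along adjacencies holds at every reachable vertex. [folklore] -/
theorem reachable_induct {G' : SimpleGraph V} (P : V → Prop) {o : V} (h0 : P o) (hstep : ∀ a b, G'.Adj a b → P a → P b)
    {w : V} (hw : G'.Reachable o w) : P w := by
  obtain ⟨p⟩ := hw
  induction p with
  | nil => exact h0
  | cons had p ih => exact ih (hstep _ _ had h0)

/-- **First entrance**: a walk ending in `Z` has a prefix that meets `Z` exactly at its endpoint. [folklore] -/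
theorem exists_first_hit {G' : SimpleGraph V} {a b : V} (p : G'.Walk a b) (Z : Set V) (hb : b ∈ Z) :
    ∃ u, u ∈ Z ∧ ∃ (π : G'.Walk a u) (r : G'.Walk u b), π.append r = p ∧ ∀ w ∈ π.support, w ∈ Z → w = u := by
  induction p with
  | nil => exact ⟨_, hb, Walk.nil, Walk.nil, rfl, fun w hw _ => by simpa using hw⟩
  | @cons c d b' had p ih =>
    by_cases hc : c ∈ Z
    · exact ⟨c, hc, Walk.nil, Walk.cons had p, rfl, fun w hw _ => by simpa using hw⟩
    · obtain ⟨u, hu, π, r, hπr, hπ⟩ := ih hb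
      refine ⟨u, hu, Walk.cons had π, r, by rw [Walk.cons_append, hπr], fun w hw hwZ => ?_⟩
      rw [Walk.support_cons, List.mem_cons] at hw
      rcases hw with rfl | hw
      · exact absurd hwZ hc
      · exact hπ w hw hwZ

/-! ## §3 Orientation of a pivotal edge -/

/-- **Orientation lemma.** If `e = {x, y}` (an edge of `H`) is pivotal for the exit event in `ω` — `ω ∪ {e}` exits, `ω ∖ {e}` does not —
then one endpoint `x₀` is joined to `o` in `ω ∖ {e}` and the other `y₀` is outside `Ω` or joined in `ω ∖ {e}` to a vertex outside `Ω`.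
[folklore] -/
theorem exists_side_of_pivotal {Ω : Set V} {o x y : V} {ω : Set (Sym2 V)} (hxy : H.Adj x y)
    (hin : insert s(x, y) ω ∈ exitEv H Ω o) (hout : ω \ {s(x, y)} ∉ exitEv H Ω o) :
    ∃ x₀ y₀, s(x₀, y₀) = s(x, y) ∧ H.Adj x₀ y₀ ∧ (og H (ω \ {s(x, y)})).Reachable o x₀ ∧
      (y₀ ∉ Ω ∨ ∃ q, q ∉ Ω ∧ (og H (ω \ {s(x, y)})).Reachable y₀ q) := by
  set ωe := ω \ {s(x, y)} with hωe
  obtain ⟨v, hvΩ, hv⟩ := hin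
  -- the set `C ∪ (reachable from x) ∪ (reachable from y)`-type closure arguments
  have key : ∀ w, (og H (insert s(x, y) ω)).Reachable o w →
      (og H ωe).Reachable o w ∨ ((og H ωe).Reachable o x ∧ (og H ωe).Reachable y w) ∨
        ((og H ωe).Reachable o y ∧ (og H ωe).Reachable x w) := by
    intro w hw
    refine reachable_induct (G' := og H (insert s(x, y) ω))
      (fun w => (og H ωe).Reachable o w ∨ ((og H ωe).Reachable o x ∧ (og H ωe).Reachable y w) ∨
        ((og H ωe).Reachable o y ∧ (og H ωe).Reachable x w)) (Or.inl (Reachable.refl o)) ?_ hw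
    intro a b hab ha
    obtain ⟨hmem, hadj⟩ := og_adj.1 hab
    by_cases he : s(a, b) = s(x, y)
    · -- the edge `e` itself: `{a, b} = {x, y}`
      rcases Sym2.eq_iff.1 he with ⟨rfl, rfl⟩ | ⟨rfl, rfl⟩
      · -- a = x, b = y
        rcases ha with h | ⟨h1, h2⟩ | ⟨h1, h2⟩
        · exact Or.inr (Or.inl ⟨h, Reachable.refl _⟩)
        · exact Or.inr (Or.inl ⟨h1, Reachable.refl _⟩)
        · exact Or.inl h1
      · -- a = y, b = x
        rcases ha with h | ⟨h1, h2⟩ | ⟨h1, h2⟩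
        · exact Or.inr (Or.inr ⟨h, Reachable.refl _⟩)
        · exact Or.inl h1
        · exact Or.inr (Or.inr ⟨h1, Reachable.refl _⟩)
    · have hab' : (og H ωe).Adj a b := by
        refine og_adj.2 ⟨?_, hadj⟩
        rcases Set.mem_insert_iff.1 hmem with h | h
        · exact absurd h he
        · exact ⟨h, he⟩
      rcases ha with h | ⟨h1, h2⟩ | ⟨h1, h2⟩
      · exact Or.inl (h.trans hab'.reachable)
      · exact Or.inr (Or.inl ⟨h1, h2.trans hab'.reachable⟩)
      · exact Or.inr (Or.inr ⟨h1, h2.trans hab'.reachable⟩)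
  rcases key v hv with h | ⟨h1, h2⟩ | ⟨h1, h2⟩
  · exact absurd ⟨v, hvΩ, h⟩ hout
  · exact ⟨x, y, rfl, hxy, h1, Or.inr ⟨v, hvΩ, h2⟩⟩
  · exact ⟨y, x, Sym2.eq_swap, hxy.symm, h1, Or.inr ⟨v, hvΩ, h2⟩⟩

/-! ## §4 Routes and the modified configuration -/

/-- **ROUTE DATA** for the local modification at a zone `Z`, relative to the reduced configuration `ωe` (the pivotal edge closed):
a route `u —R₁→ a`, an `H`-edge `f = {a, b}`, a route `b —R₂→ v`, with disjoint supports inside `Z`, `V(R₁) ⊆ Ω`; an `ωe`-open walk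
`o ↔ u` meeting `Z` only at `u`; and `v ∉ Ω` or an `ωe`-open walk from `v` to a vertex outside `Ω` meeting `Z` only at `v`.
[cite: BalisterBollobasRiordan2014, §"bond percolation" p. 13] -/
structure RouteData (H : SimpleGraph V) (ωe : Set (Sym2 V)) (Ω Z : Set V) (o : V) where
  /-- start of the route (first `Z`-vertex seen from `o`) -/
  u : V
  /-- near endpoint of the enhancement edge -/
  a : V
  /-- far endpoint of the enhancement edge -/
  b : V
  /-- end of the route -/
  v : V
  /-- first half of the route -/
  R₁ : H.Walk u a
  /-- the enhancement edge is an edge of `H` -/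
  hab : H.Adj a b
  /-- second half of the route -/
  R₂ : H.Walk b v
  /-- the two halves are vertex-disjoint -/
  disj : ∀ w, w ∈ R₁.support → w ∈ R₂.support → False
  /-- the route lies in the zone -/
  sub₁ : ∀ w ∈ R₁.support, w ∈ Z
  /-- the route lies in the zone -/
  sub₂ : ∀ w ∈ R₂.support, w ∈ Z
  /-- the first half avoids `F = Ωᶜ` -/
  R₁Ω : ∀ w ∈ R₁.support, w ∈ Ω
  /-- the access walk from the root -/
  π : (og H ωe).Walk o u
  /-- it meets the zone only at `u` -/
  hπ : ∀ w ∈ π.support, w ∈ Z → w = u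
  /-- the exit from `v` -/
  hv : v ∉ Ω ∨ ∃ q, q ∉ Ω ∧ ∃ ρ : (og H ωe).Walk v q, ∀ w ∈ ρ.support, w ∈ Z → w = v

namespace RouteData

variable {ωe : Set (Sym2 V)} {Ω Z : Set V} {o : V} (D : RouteData H ωe Ω Z o)

/-- The vertex set `T = V(R₁) ∪ V(R₂)` of the route. [folklore] -/
def T : Set V := {w | w ∈ D.R₁.support ∨ w ∈ D.R₂.support}

/-- The open route edges (all edges of `R₁` and `R₂`; NOT `f`). [folklore] -/
def Ropen : Set (Sym2 V) := {d | d ∈ D.R₁.edges ∨ d ∈ D.R₂.edges}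

/-- **THE MODIFIED CONFIGURATION**: outside `T` as `ωe`; edges between `{u, v}` and the outside as `ωe`; inside `T` exactly the route
edges; everything else touching `T` closed. [cite: BalisterBollobasRiordan2014, §"bond percolation" p. 13] -/
def modify : Set (Sym2 V) :=
  {d | d ∈ ωe ∧ ∀ w ∈ d, w ∉ D.T} ∪ {d | d ∈ ωe ∧ ∃ w w', d = s(w, w') ∧ (w = D.u ∨ w = D.v) ∧ w' ∉ D.T} ∪ D.Ropen

/-- `T ⊆ Z`. [folklore] -/
theorem T_subset : D.T ⊆ Z := by
  rintro w (h | h)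
  · exact D.sub₁ w h
  · exact D.sub₂ w h

/-- `u ∈ T`. [folklore] -/
theorem u_mem_T : D.u ∈ D.T := Or.inl D.R₁.start_mem_support

/-- `v ∈ T`. [folklore] -/
theorem v_mem_T : D.v ∈ D.T := Or.inr D.R₂.end_mem_support

/-- `a ∈ T`. [folklore] -/
theorem a_mem_T : D.a ∈ D.T := Or.inl D.R₁.end_mem_support

/-- `b ∈ T`. [folklore] -/
theorem b_mem_T : D.b ∈ D.T := Or.inr D.R₂.start_mem_support

/-- `u ∉ V(R₂)`. [folklore] -/
theorem u_not_mem_R₂ : D.u ∉ D.R₂.support := fun h => D.disj _ D.R₁.start_mem_support h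

/-- `v ∉ V(R₁)`. [folklore] -/
theorem v_not_mem_R₁ : D.v ∉ D.R₁.support := fun h => D.disj _ h D.R₂.end_mem_support

/-- The access walk avoids `T ∖ {u}`. [folklore] -/
theorem π_avoids {w : V} (hw : w ∈ D.π.support) (hT : w ∈ D.T) : w = D.u := D.hπ w hw (D.T_subset hT)

/-- `v` is not joined to `o` in `ωe` when `ωe` does not exit. [folklore] -/
theorem not_reachable_v (hωe : ωe ∉ exitEv H Ω o) : ¬ (og H ωe).Reachable o D.v := by
  intro h
  rcases D.hv with hv | ⟨q, hq, ρ, -⟩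
  · exact hv (mem_of_reachable_of_not_exit hωe h)
  · exact hq (mem_of_reachable_of_not_exit hωe (h.trans ρ.reachable))

/-- The enhancement edge is closed in the modified configuration. [folklore] -/
theorem f_not_mem_modify : s(D.a, D.b) ∉ D.modify := by
  rintro ((⟨-, h⟩ | ⟨-, w, w', he, -, hw'⟩) | (h | h))
  · exact h D.a (Sym2.mem_mk_left _ _) D.a_mem_T
  · rcases Sym2.eq_iff.1 he with ⟨-, h2⟩ | ⟨h1, -⟩
    · exact hw' (h2 ▸ D.b_mem_T)
    · exact hw' (h1 ▸ D.a_mem_T)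
  · exact D.disj _ (D.R₁.snd_mem_support_of_mem_edges h) D.R₂.start_mem_support
  · exact D.disj _ D.R₁.end_mem_support (D.R₂.fst_mem_support_of_mem_edges h)

/-- Off the zone the modified configuration agrees with `ωe`. [folklore] -/
theorem modify_iff_of_not_mem {d : Sym2 V} (hd : ∀ w ∈ d, w ∉ Z) : d ∈ D.modify ↔ d ∈ ωe := by
  constructor
  · rintro ((⟨h, -⟩ | ⟨h, -⟩) | (h | h))
    · exact h
    · exact h
    · induction d using Sym2.inductionOn with
      | hf w w' => exact absurd (D.sub₁ _ (D.R₁.fst_mem_support_of_mem_edges h)) (hd w (Sym2.mem_mk_left _ _))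
    · induction d using Sym2.inductionOn with
      | hf w w' => exact absurd (D.sub₂ _ (D.R₂.fst_mem_support_of_mem_edges h)) (hd w (Sym2.mem_mk_left _ _))
  · intro h
    exact Or.inl (Or.inl ⟨h, fun w hw hT => hd w hw (D.T_subset hT)⟩)

/-- The modified configuration consists of `ωe`-edges and `H`-edges meeting the zone. [folklore] -/
theorem modify_subset {d : Sym2 V} (hd : d ∈ D.modify) : d ∈ ωe ∨ (d ∈ H.edgeSet ∧ ∃ w ∈ d, w ∈ Z) := by
  rcases hd with (⟨h, -⟩ | ⟨h, -⟩) | (h | h)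
  · exact Or.inl h
  · exact Or.inl h
  · induction d using Sym2.inductionOn with
    | hf w w' => exact Or.inr ⟨D.R₁.edges_subset_edgeSet h, w, Sym2.mem_mk_left _ _, D.sub₁ _ (D.R₁.fst_mem_support_of_mem_edges h)⟩
  · induction d using Sym2.inductionOn with
    | hf w w' => exact Or.inr ⟨D.R₂.edges_subset_edgeSet h, w, Sym2.mem_mk_left _ _, D.sub₂ _ (D.R₂.fst_mem_support_of_mem_edges h)⟩

/-- The vertices the root can see without `f`: those joined to `o` in `ωe` avoiding `T ∖ {u}`, and `V(R₁)`. [folklore] -/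
def Good (w : V) : Prop := (∃ γ : (og H ωe).Walk o w, ∀ z ∈ γ.support, z ∈ D.T → z = D.u) ∨ w ∈ D.R₁.support

/-- `u` is good (via the access walk). [folklore] -/
theorem good_u : D.Good D.u := Or.inl ⟨D.π, fun _ hz hT => D.π_avoids hz hT⟩

/-- Good vertices lie in `Ω` (when `ωe` does not exit). [folklore] -/
theorem good_mem (hωe : ωe ∉ exitEv H Ω o) {w : V} (hw : D.Good w) : w ∈ Ω := by
  rcases hw with ⟨γ, -⟩ | h
  · exact mem_of_reachable_of_not_exit hωe γ.reachable
  · exact D.R₁Ω w h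

/-- **Closure**: without `f`, every open edge of the modified configuration leads from a good vertex to a good vertex.
[cite: BalisterBollobasRiordan2014, §"bond percolation" p. 13] -/
theorem good_step (hωe : ωe ∉ exitEv H Ω o) {w w' : V} (hadj : (og H D.modify).Adj w w') (hw : D.Good w) : D.Good w' := by
  obtain ⟨hmem, hH⟩ := og_adj.1 hadj
  rcases hmem with (⟨hωe', hT⟩ | ⟨hωe', z, z', he, hz, hz'⟩) | (h | h)
  · -- an `ωe`-edge not touching `T`
    rcases hw with ⟨γ, hγ⟩ | hR
    · refine Or.inl ⟨γ.append (Walk.cons (og_adj.2 ⟨hωe', hH⟩) Walk.nil), fun z hz hzT => ?_⟩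
      rw [Walk.support_append] at hz
      rcases List.mem_append.1 hz with hz | hz
      · exact hγ z hz hzT
      · simp only [Walk.support_cons, Walk.support_nil, List.tail_cons, List.mem_singleton] at hz
        subst hz
        exact absurd hzT (hT _ (Sym2.mem_mk_right _ _))
    · exact absurd (Or.inl hR) (hT w (Sym2.mem_mk_left _ _))
  · -- an `ωe`-edge from `u` or `v` to the outside
    have hzadj : (og H ωe).Adj z z' := og_adj.2 ⟨he ▸ hωe', by
      have := hH; rcases Sym2.eq_iff.1 he with ⟨rfl, rfl⟩ | ⟨rfl, rfl⟩
      · exact this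
      · exact this.symm⟩
    rcases Sym2.eq_iff.1 he with ⟨rfl, rfl⟩ | ⟨rfl, rfl⟩
    · -- w = z ∈ {u, v}, w' = z' ∉ T
      rcases hz with rfl | rfl
      · obtain ⟨γ, hγ⟩ | hR := D.good_u
        · refine Or.inl ⟨γ.append (Walk.cons hzadj Walk.nil), fun t ht htT => ?_⟩
          rw [Walk.support_append] at ht
          rcases List.mem_append.1 ht with ht | ht
          · exact hγ t ht htT
          · simp only [Walk.support_cons, Walk.support_nil, List.tail_cons, List.mem_singleton] at ht
            subst ht; exact absurd htT hz'
        · refine Or.inl ⟨D.π.append (Walk.cons hzadj Walk.nil), fun t ht htT => ?_⟩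
          rw [Walk.support_append] at ht
          rcases List.mem_append.1 ht with ht | ht
          · exact D.π_avoids ht htT
          · simp only [Walk.support_cons, Walk.support_nil, List.tail_cons, List.mem_singleton] at ht
            subst ht; exact absurd htT hz'
      · -- w = v is good: impossible
        exfalso
        rcases hw with ⟨γ, -⟩ | hR
        · exact D.not_reachable_v hωe γ.reachable
        · exact D.v_not_mem_R₁ hR
    · -- w = z' ∉ T, w' = z ∈ {u, v}
      rcases hz with rfl | rfl
      · exact Or.inr D.R₁.start_mem_support
      · exfalso
        rcases hw with ⟨γ, -⟩ | hR
        · exact D.not_reachable_v hωe (γ.reachable.trans hzadj.symm.reachable)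
        · exact hz' (Or.inl hR)
  · -- an edge of `R₁`
    exact Or.inr (D.R₁.snd_mem_support_of_mem_edges h)
  · -- an edge of `R₂`: `w` cannot be good
    exfalso
    have hw2 : w ∈ D.R₂.support := D.R₂.fst_mem_support_of_mem_edges h
    rcases hw with ⟨γ, hγ⟩ | hR
    · have := hγ w γ.end_mem_support (Or.inr hw2)
      exact D.u_not_mem_R₂ (this ▸ hw2)
    · exact D.disj w hR hw2

/-- **(i) Without `f` the modified configuration does not exit.** [cite: BalisterBollobasRiordan2014, §"bond percolation" p. 13] -/
theorem modify_not_mem (hωe : ωe ∉ exitEv H Ω o) : D.modify ∉ exitEv H Ω o := by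
  rintro ⟨w, hwΩ, hw⟩
  have h0 : D.Good o := by
    refine Or.inl ⟨Walk.nil, fun z hz hzT => ?_⟩
    rw [Walk.support_nil, List.mem_singleton] at hz
    subst hz
    exact D.π_avoids D.π.start_mem_support hzT
  exact hwΩ (D.good_mem hωe (reachable_induct D.Good h0 (fun a b hab ha => D.good_step hωe hab ha) hw))

/-- An `ωe`-open walk meeting `Z` at most in its endpoint `c ∈ {u, v}` stays open in the modified configuration plus `f`. [folklore] -/
theorem transfer_access {c d : V} (γ : (og H ωe).Walk d c) (hc : c = D.u ∨ c = D.v) (hγ : ∀ w ∈ γ.support, w ∈ Z → w = c) :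
    (og H (insert s(D.a, D.b) D.modify)).Reachable d c := by
  refine ⟨γ.transfer _ fun g hg => ?_⟩
  induction g using Sym2.inductionOn with
  | hf w w' =>
    have hadj := γ.adj_of_mem_edges hg
    obtain ⟨hωe', hH⟩ := og_adj.1 hadj
    have hw : w ∈ γ.support := γ.fst_mem_support_of_mem_edges hg
    have hw' : w' ∈ γ.support := γ.snd_mem_support_of_mem_edges hg
    rw [mem_edgeSet]
    refine og_adj.2 ⟨Set.mem_insert_of_mem _ ?_, hH⟩
    by_cases hwT : w ∈ D.T
    · have hwc : w = c := hγ w hw (D.T_subset hwT)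
      have hw'T : w' ∉ D.T := fun h => hH.ne (hwc.trans (hγ w' hw' (D.T_subset h)).symm)
      exact Or.inl (Or.inr ⟨hωe', w, w', rfl, hwc ▸ hc, hw'T⟩)
    · by_cases hw'T : w' ∈ D.T
      · have hw'c : w' = c := hγ w' hw' (D.T_subset hw'T)
        exact Or.inl (Or.inr ⟨hωe', w', w, Sym2.eq_swap, hw'c ▸ hc, hwT⟩)
      · refine Or.inl (Or.inl ⟨hωe', fun z hz => ?_⟩)
        rcases Sym2.mem_iff.1 hz with rfl | rfl
        · exact hwT
        · exact hw'T

/-- A walk of `H` whose edges are route edges stays open in the modified configuration plus `f`. [folklore] -/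
theorem transfer_route {c d : V} (γ : H.Walk c d) (hγ : ∀ g ∈ γ.edges, g ∈ D.Ropen) :
    (og H (insert s(D.a, D.b) D.modify)).Reachable c d := by
  refine ⟨γ.transfer _ fun g hg => ?_⟩
  induction g using Sym2.inductionOn with
  | hf w w' =>
    rw [mem_edgeSet]
    exact og_adj.2 ⟨Set.mem_insert_of_mem _ (Or.inr (hγ _ hg)), γ.adj_of_mem_edges hg⟩

/-- **(ii) With `f` the modified configuration exits.** [cite: BalisterBollobasRiordan2014, §"bond percolation" p. 13] -/
theorem insert_mem : insert s(D.a, D.b) D.modify ∈ exitEv H Ω o := by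
  have h1 : (og H (insert s(D.a, D.b) D.modify)).Reachable o D.u :=
    D.transfer_access D.π (Or.inl rfl) D.hπ
  have h2 : (og H (insert s(D.a, D.b) D.modify)).Reachable D.u D.a :=
    D.transfer_route D.R₁ fun g hg => Or.inl hg
  have h3 : (og H (insert s(D.a, D.b) D.modify)).Reachable D.a D.b :=
    (og_adj.2 ⟨Set.mem_insert _ _, D.hab⟩).reachable
  have h4 : (og H (insert s(D.a, D.b) D.modify)).Reachable D.b D.v :=
    D.transfer_route D.R₂ fun g hg => Or.inr hg
  have h14 := ((h1.trans h2).trans h3).trans h4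
  rcases D.hv with hv | ⟨q, hq, ρ, hρ⟩
  · exact ⟨D.v, hv, h14⟩
  · exact ⟨q, hq, h14.trans (D.transfer_access ρ.reverse (Or.inr rfl) (by
      intro w hw hwZ; rw [Walk.support_reverse, List.mem_reverse] at hw; exact hρ w hw hwZ)).symm⟩

end RouteData

end SubLoc

end Summit.CriticalPhenomena.PercolationContinuityZ3.Theorems.Transplant
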